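import Literature.AlgebraicGeometry.Frobenioids.PadicKummerRemark242Functor
import Literature.AlgebraicGeometry.Frobenioids.ZetaPowerMapTorsion
import HarnessLib

/-!
# Frobenioids II, Remark 2.4.2 at the functor level, ARBITRARY level `N`: `Ψ_ζ` acts on `F_N(A)` by the image
# of `ζ ∈ Ẑ` in `ℤ/Nℤ`

S. Mochizuki, *The geometry of Frobenioids II: poly-Frobenioids*, Kyushu J. Math. **62** (2008) 401–460,
§2, Remark 2.4.2 p. 22 [cite: MochizukiFrdII2008, Rmk 2.4.2 p.22]: the unit-wise Frobenius functor "acts on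
`F_N(Aᵢ)` [relative to the natural isomorphisms `F_N(Aᵢ) ⥲ ℤ/Nℤ`] by 'raising to the `ζ`-th power'" — for
`ζ : Primes → ℕ_{≥1}` read as the element `(ζ(l))_l ∈ ∏_l ℤ_l = Ẑ` ([FrdI] Def. 2.8 (iii)), whose image in
`ℤ/Nℤ` is any `Z` with `Z ≡ ζ(l) (mod l^{v_l(N)})` for all `l`.

PROOF-ONLY sequel (abc-iut cell, layer L1, seat abc-iut-w5-d248 gen 3; SUBDAG-FrdII-Thm24 row L26, sub-piece
(α-ζ) of GAP row G-L1t7-α) to `PadicKummerRemark242Functor.lean` (there: `N = l^k`, exponent `ζ(l)`), using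
the torsion lemma `IsZetaPowerMap.eq_pow_of_pow_eq_one` (`ZetaPowerMapTorsion.lean`): for EVERY `N ≠ 0` and
every `ζ`-exponent `Z` modulo `N`, the automorphism of the Definition 2.2 context of `A` induced by `Ψ_ζ`
(abc-iut-L1-t7's `GaloisChart.isoOfFunctor`) raises `μ_N(A)` to the `Z`-th power
(`muIso_isoOfFunctor_psiStrict_of_zetaExponent`), hence acts on `F_N(A)` by `Z` relative to every invariant
datum (`actsOnFNByPower_unitWiseFrobenius_of_zetaExponent`) and is `InvariantIncompatible` whenever
`Z ≢ 1 (mod N)` (`invariantIncompatible_unitWiseFrobenius_of_zetaExponent`). Nothing here concerns [IUTchIII];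
no statement of [FrdII] is restated.
-/

noncomputable section

namespace Literature.AlgebraicGeometry.Frobenioids

open CategoryTheory Opposite Function Field IntermediateField Kummer
open Literature.NumberTheory.GaloisRepresentations

/-! ### [FrdI] Prop. 2.9 (ii)(c) on the `N`-torsion of `O^×(A)`, arbitrary `N` -/

namespace PreFrobenioid.UnitWiseFrobeniusZeta

universe w v v' u u'

variable {D : Type u} [Category.{v} D] {Φ : Dᵒᵖ ⥤ CommMonCat.{w}}
  {C : Type u'} [Category.{v'} C] {F : C ⥤ ElemFrobenioid Φ}
  (hF : IsFrobenioid F) (τ : CharacteristicSplitting F) (hnorm : IsOfType (IsFrobeniusNormalized F))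
  (hbt : IsOfType (IsBaseTrivial F)) (histr : IsOfIsotropicType F) (hup : IsOfUnitProfiniteType F)
  {P : Presection C} {Fr : ℕ+ →* End P.ι} (hpair : IsBaseFrobeniusPair F P Fr) (ζ : Nat.Primes → ℕ+)

/-- A unit killed by `N ≠ 0` is sent by the `ζ`-th power map to its `Z`-th power for every `ζ`-exponent `Z`
modulo `N`. [cite: MochizukiFrdI2008, Def. 2.8(iii) p.52] -/
theorem zetaPow_of_pow_eq_one' {A : C} {N : ℕ} (hN : N ≠ 0) {Z : ℕ}
    (hZ : ∀ l : Nat.Primes, Z ≡ ((ζ l : ℕ+) : ℕ) [MOD ordProj[(l : ℕ)] N]) (u : unitsSubgroup F A)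
    (hu : u ^ N = 1) : zetaPow hF hup ζ A u = u ^ Z :=
  letI : CommGroup (unitsSubgroup F A) := unitsCommGroup F hF A
  letI : TopologicalSpace (unitsSubgroup F A) := unitsTopology hup A
  (isZetaPowerMap_zetaPow hF hup ζ A).eq_pow_of_pow_eq_one hN hZ hu

/-- **Prop. 2.9 (ii)(c) on the `N`-torsion**: a unit `u ∈ O^×(A)` with `u^N = 1` satisfies `Ψ(u) = u^Z` for
every `ζ`-exponent `Z` modulo `N`. [cite: MochizukiFrdI2008, Prop. 2.9(ii) p.53] -/
theorem psiStrict_map_unit_of_pow_eq_one' {A : C} {N : ℕ} (hN : N ≠ 0) {Z : ℕ}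
    (hZ : ∀ l : Nat.Primes, Z ≡ ((ζ l : ℕ+) : ℕ) [MOD ordProj[(l : ℕ)] N]) (u : unitsSubgroup F A)
    (hu : u ^ N = 1) :
    (psiStrict hF τ hnorm hbt histr hup hpair ζ).map u.1.hom = ((u ^ Z : unitsSubgroup F A) : Aut A).hom := by
  rw [psiStrict_map_unit, zetaPow_of_pow_eq_one' hF hup ζ hN hZ u hu]

end PreFrobenioid.UnitWiseFrobeniusZeta

/-! ### Remark 2.4.2 for `Ψ_ζ` at an arbitrary level `N` -/

namespace PadicFrd.Datum.GaloisChart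

open PreFrobenioid PreFrobenioid.UnitWiseFrobeniusZeta PadicKummer PadicKummer.Def22Context

variable {D : Type} [SmallCategory D] {p : ℕ} [Fact p.Prime] {d : Datum D p}
  (hF : IsFrobenioid d.structureFunctor) (τ : CharacteristicSplitting d.structureFunctor)
  (hnorm : IsOfType (IsFrobeniusNormalized d.structureFunctor))
  (hbt : IsOfType (IsBaseTrivial d.structureFunctor)) (histr : IsOfIsotropicType d.structureFunctor)
  (hup : IsOfUnitProfiniteType d.structureFunctor)
  {P : Presection d.frobenioid} {Fr : ℕ+ →* End P.ι} (hpair : IsBaseFrobeniusPair d.structureFunctor P Fr)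
  (ζ : Nat.Primes → ℕ+) (hζ : IsOfCoprimeType ζ)
  {A : d.frobenioid} {K : Type} [Field K] {L : IntermediateField K (AlgebraicClosure K)}
  [Normal K L] [FiniteDimensional K L] (c : GaloisChart d A K L)
  (hker : ∀ α : Aut A, c.res α = 1 ↔ α.hom ∈ PreFrobenioid.endSubmonoid d.structureFunctor A)
  (H : Subgroup (absoluteGaloisGroup K)) [H.Normal] (hH : IsOpen (H : Set (absoluteGaloisGroup K)))
  {N : ℕ} (hN : N ≠ 0) {Z : ℕ} (hZ : ∀ l : Nat.Primes, Z ≡ ((ζ l : ℕ+) : ℕ) [MOD ordProj[(l : ℕ)] N])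

include hN hZ in
/-- **`Ψ_ζ` raises `μ_N(A)` to the `Z`-th power** for every `ζ`-exponent `Z` modulo `N`, as endomorphisms of
`A`. [cite: MochizukiFrdI2008, Prop. 2.9(ii) p.53] -/
theorem psiStrict_map_mu_of_zetaExponent (ζ₀ : Mu N (ObjMonoid d A)) :
    (psiStrict hF τ hnorm hbt histr hup hpair ζ).map (ζ₀.val : ObjMonoid d A).hom =
      ((ζ₀ ^ Z).val : ObjMonoid d A).hom := by
  rw [← hom_unitOf_mu, psiStrict_map_unit_of_pow_eq_one' hF τ hnorm hbt histr hup hpair ζ hN hZ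
    (unitOf (isUnit_val_mu _ ζ₀)) (unitOf_mu_pow_eq_one _ ζ₀), hom_unitOf_mu_pow]

include hN hZ in
/-- **The context automorphism induced by `Ψ_ζ` raises `μ_N(A)` to the `Z`-th power** (`Z` any `ζ`-exponent
modulo `N`). [cite: MochizukiFrdII2008, Rmk 2.4.2 p.22] -/
theorem muIso_isoOfFunctor_psiStrict_of_zetaExponent (ζ₀ : Mu N (ofChart c H hH).O) :
    haveI := full_psiStrict hF τ hnorm hbt histr hup hpair ζ hζ
    haveI := faithful_psiStrict hF τ hnorm hbt histr hup hpair ζ hζ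
    (isoOfFunctor (psiStrict hF τ hnorm hbt histr hup hpair ζ) c c (hO_psiStrict hF τ hnorm hbt histr hup hpair ζ)
      hker hker H hH H hH (ContinuousMulEquiv.refl _)
      (houter_psiStrict hF τ hnorm hbt histr hup hpair ζ hζ c hker) (map_H_refl H) Iff.rfl).muIso N ζ₀ =
      ζ₀ ^ Z := by
  apply Mu.ext
  apply Units.ext
  rw [Def22Context.Iso.coe_val_muIso]
  apply ObjMonoid.ext
  change ((psiStrict hF τ hnorm hbt histr hup hpair ζ).map (ζ₀.val : ObjMonoid d A).hom) = _
  exact psiStrict_map_mu_of_zetaExponent hF τ hnorm hbt histr hup hpair ζ hN hZ ζ₀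

include hN hZ in
/-- **Remark 2.4.2, arbitrary `N` — "acts on `F_N(Aᵢ)` … by raising to the `ζ`-th power"**: the isomorphism
`F_N(A) ⥲ F_N(A)` induced by the unit-wise Frobenius functor `Ψ_ζ` is multiplication by the `ζ`-exponent `Z`
(the image of `ζ ∈ Ẑ` in `ℤ/Nℤ`), relative to EVERY invariant datum. [cite: MochizukiFrdII2008, Rmk 2.4.2 p.22] -/
theorem actsOnFNByPower_unitWiseFrobenius_of_zetaExponent (inv : FNInvariant (ofChart c H hH) N) :
    haveI := full_psiStrict hF τ hnorm hbt histr hup hpair ζ hζ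
    haveI := faithful_psiStrict hF τ hnorm hbt histr hup hpair ζ hζ
    ActsOnFNByPower (ofChart c H hH) (ofChart c H hH) N
      ((isoOfFunctor (psiStrict hF τ hnorm hbt histr hup hpair ζ) c c
        (hO_psiStrict hF τ hnorm hbt histr hup hpair ζ) hker hker H hH H hH (ContinuousMulEquiv.refl _)
        (houter_psiStrict hF τ hnorm hbt histr hup hpair ζ hζ c hker) (map_H_refl H) Iff.rfl).thm24Data N)
      inv inv (Z : ZMod N) :=
  Def22Context.Iso.actsOnFNByPower_of_muIso_eq_pow _ _ _
    (isoE_isoOfFunctor_psiStrict hF τ hnorm hbt histr hup hpair ζ hζ c hker H hH)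
    (muIso_isoOfFunctor_psiStrict_of_zetaExponent hF τ hnorm hbt histr hup hpair ζ hζ c hker H hH hN hZ) inv

include hN hZ in
/-- **Remark 2.4.2, arbitrary `N` — the incompatibility**: if the `ζ`-exponent `Z` is `≢ 1 (mod N)` (i.e.
`ζ(l) ≢ 1 (mod l^{v_l(N)})` for some `l ∣ N`), the isomorphism `F_N(A) ⥲ F_N(A)` induced by `Ψ_ζ` is NOT
compatible with the natural isomorphisms `F_N(A) ⥲ ℤ/Nℤ`, for every invariant datum.
[cite: MochizukiFrdII2008, Rmk 2.4.2 p.22] -/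
theorem invariantIncompatible_unitWiseFrobenius_of_zetaExponent (hZ1 : (Z : ZMod N) ≠ 1)
    (inv : FNInvariant (ofChart c H hH) N) :
    haveI := full_psiStrict hF τ hnorm hbt histr hup hpair ζ hζ
    haveI := faithful_psiStrict hF τ hnorm hbt histr hup hpair ζ hζ
    InvariantIncompatible (ofChart c H hH) (ofChart c H hH) N
      ((isoOfFunctor (psiStrict hF τ hnorm hbt histr hup hpair ζ) c c
        (hO_psiStrict hF τ hnorm hbt histr hup hpair ζ) hker hker H hH H hH (ContinuousMulEquiv.refl _)
        (houter_psiStrict hF τ hnorm hbt histr hup hpair ζ hζ c hker) (map_H_refl H) Iff.rfl).thm24Data N)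
      inv inv :=
  Def22Context.Iso.invariantIncompatible_of_muIso_eq_pow _ _ _
    (isoE_isoOfFunctor_psiStrict hF τ hnorm hbt histr hup hpair ζ hζ c hker H hH)
    (muIso_isoOfFunctor_psiStrict_of_zetaExponent hF τ hnorm hbt histr hup hpair ζ hζ c hker H hH hN hZ) hZ1 inv

include hN in
/-- **Remark 2.4.2, arbitrary `N`, exponent packaged**: there is a `ζ`-exponent `Z` modulo `N` (Chinese
remainder), and `Ψ_ζ` acts on `F_N(A)` by it relative to every invariant datum.
[cite: MochizukiFrdII2008, Rmk 2.4.2 p.22] -/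
theorem exists_zetaExponent_actsOnFNByPower_unitWiseFrobenius :
    ∃ Z : ℕ, (∀ l : Nat.Primes, Z ≡ ((ζ l : ℕ+) : ℕ) [MOD ordProj[(l : ℕ)] N]) ∧
      ∀ inv : FNInvariant (ofChart c H hH) N,
        haveI := full_psiStrict hF τ hnorm hbt histr hup hpair ζ hζ
        haveI := faithful_psiStrict hF τ hnorm hbt histr hup hpair ζ hζ
        ActsOnFNByPower (ofChart c H hH) (ofChart c H hH) N
          ((isoOfFunctor (psiStrict hF τ hnorm hbt histr hup hpair ζ) c c
            (hO_psiStrict hF τ hnorm hbt histr hup hpair ζ) hker hker H hH H hH (ContinuousMulEquiv.refl _)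
            (houter_psiStrict hF τ hnorm hbt histr hup hpair ζ hζ c hker) (map_H_refl H) Iff.rfl).thm24Data N)
          inv inv (Z : ZMod N) := by
  obtain ⟨Z, hZ⟩ := exists_zetaExponent ζ N
  exact ⟨Z, hZ, fun inv =>
    actsOnFNByPower_unitWiseFrobenius_of_zetaExponent hF τ hnorm hbt histr hup hpair ζ hζ c hker H hH hN hZ inv⟩

end PadicFrd.Datum.GaloisChart

end Literature.AlgebraicGeometry.Frobenioids

end
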